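import Mathlib
import Literature.Probability.LatticeModels.TemperleyLiebBaxterization
import Literature.Probability.Percolation.DiagonalColumnPatterns
import Literature.Probability.Percolation.DiagonalStripTransferInhomogeneous
import Literature.Probability.Percolation.DiagonalStripGenericRapidities
import HarnessLib

/-!
# The swap automorphisms of the rapidity field and the transfer matrix

Topic `Literature/Probability/Percolation`. In the generic setting of
`DiagonalStripGenericRapidities.lean` the substitution `z⃗ ↦ s_i z⃗` of Ikhlef–Ponsaing's qKZ system
(J. Stat. Phys. 149 (2012), arXiv:1202.5476, §3.4) is the field automorphism `genSwap i` of
`Frac K₀[X]` induced by renaming `X_i ↔ X_{i+1}`; this file proves that `t(w; z⃗)` is a rational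
function of its parameters in the sense that it commutes with field homomorphisms
(`map_ipTransferMatrixW`, with `map_qbr`, `map_ipRowWeight`, `map_ipTransferW`, `map_ipTwoLayerW`), and
hence **`genSwap_ipTransferMatrixW`**: `σ_i (t(w; z⃗)) = t(w; s_i z⃗)` entrywise — the form in which
the interlacing relations act on vectors of rational functions.

## References

* Y. Ikhlef, A. K. Ponsaing, J. Stat. Phys. 149 (2012) 10–36, arXiv:1202.5476, §3.4.
  [IkhlefPonsaing2012]
-/

namespace Literature.Probability.Percolation

open Literature.Probability.LatticeModels

variable {m : ℕ}

/-! ### Ring homomorphisms act on the transfer matrix entrywise -/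

section Map

variable {K K' : Type*} [Field K] [Field K']

open Literature.Probability.LatticeModels.TemperleyLieb

/-- `[·]` commutes with field homomorphisms. [folklore] -/
theorem map_qbr (φ : K →+* K') (x : K) : φ (qbr x) = qbr (φ x) := by
  unfold qbr; rw [map_sub, map_inv₀]

/-- `A` commutes with field homomorphisms. [folklore] -/
theorem map_ipWtA (φ : K →+* K') (q x : K) : φ (ipWtA q x) = ipWtA (φ q) (φ x) := by
  unfold ipWtA; rw [map_div₀, map_qbr, map_qbr, map_mul, map_div₀]

/-- `B` commutes with field homomorphisms. [folklore] -/
theorem map_ipWtB (φ : K →+* K') (q x : K) : φ (ipWtB q x) = ipWtB (φ q) (φ x) := by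
  unfold ipWtB; rw [map_div₀, map_qbr, map_qbr, map_div₀]

/-- The row weights commute with field homomorphisms. [folklore] -/
theorem map_ipRowWeight (φ : K →+* K') (q w : K) (z : ℕ → K) (r : Fin 2) (e : Sym2 (Site 2)) :
    φ (ipRowWeight q w z r e) = ipRowWeight (φ q) (φ w) (φ ∘ z) r e := by
  unfold ipRowWeight
  split_ifs <;> simp only [map_ipWtA, map_ipWtB, map_div₀, map_inv₀, map_mul, Function.comp]

/-- The weighted layer kernel commutes with ring homomorphisms. [folklore] -/
theorem map_ipTransferW (φ : K →+* K') (c : ℤ) (p : Sym2 (Site 2) → K) (P P' : ColPattern m) :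
    φ (ipTransferW m c p P P') = ipTransferW m c (φ ∘ p) P P' := by
  unfold ipTransferW
  rw [map_sum]
  refine Finset.sum_congr rfl fun U _ => ?_
  split_ifs
  · simp only [map_mul, map_prod, map_sub, map_one, Function.comp]
  · exact map_zero φ

/-- The two-layer kernel commutes with ring homomorphisms. [folklore] -/
theorem map_ipTwoLayerW (φ : K →+* K') (p₀ p₁ : Sym2 (Site 2) → K) (Q Q' : ColPattern m) :
    φ (ipTwoLayerW m p₀ p₁ Q Q') = ipTwoLayerW m (φ ∘ p₀) (φ ∘ p₁) Q Q' := by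
  unfold ipTwoLayerW
  simp only [map_sum, map_mul, map_ipTransferW]

/-- **`t(w; z⃗)` commutes with field homomorphisms** (it is a rational function of the parameters).
[folklore] -/
theorem map_ipTransferMatrixW (φ : K →+* K') (q w : K) (z : ℕ → K) (Q Q' : ColPattern m) :
    φ (ipTransferMatrixW m q w z Q Q') = ipTransferMatrixW m (φ q) (φ w) (φ ∘ z) Q Q' := by
  rw [ipTransferMatrixW_eq, ipTransferMatrixW_eq, map_ipTwoLayerW]
  congr 1 <;> funext e <;> exact map_ipRowWeight φ q w z _ e

end Map

/-! ### The swap automorphisms of the rapidity field -/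

section Swap

open MvPolynomial

variable (K₀ : Type*) [Field K₀]

/-- The automorphism of the rapidity field exchanging `z_i` and `z_{i+1}`. [folklore] -/
noncomputable def genSwap (i : ℕ) : RapidityField K₀ ≃+* RapidityField K₀ :=
  IsFractionRing.ringEquivOfRingEquiv (renameEquiv K₀ (Equiv.swap i (i + 1))).toRingEquiv

variable {K₀}

/-- The swap on the generators. [folklore] -/
theorem genSwap_toRF (i : ℕ) (P : MvPolynomial ℕ K₀) :
    genSwap K₀ i (toRF K₀ P) = toRF K₀ (rename (Equiv.swap i (i + 1)) P) :=
  IsFractionRing.ringEquivOfRingEquiv_algebraMap _ P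

/-- The swap exchanges the two rapidities and fixes the others: `σ_i ∘ z = zswap z i`. [folklore] -/
theorem genSwap_genZ (i k : ℕ) : genSwap K₀ i (genZ K₀ k) = zswap (genZ K₀) i k := by
  unfold genZ
  rw [genSwap_toRF, rename_X, zswap, Equiv.swap_apply_def]
  split_ifs <;> rfl

/-- The swap fixes `w` (for `i ≥ 1`). [folklore] -/
theorem genSwap_genW {i : ℕ} (hi : i ≠ 0) : genSwap K₀ i (genW K₀) = genW K₀ := by
  unfold genW
  rw [genSwap_toRF, rename_X, Equiv.swap_apply_of_ne_of_ne hi.symm (by omega)]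

/-- The swap fixes the constants. [folklore] -/
theorem genSwap_genC (i : ℕ) (q : K₀) : genSwap K₀ i (genC K₀ q) = genC K₀ q := by
  unfold genC
  rw [genSwap_toRF, rename_C]

/-- **`t(w; s_i z⃗) = σ_i (t(w; z⃗))`** for the generic transfer matrix (`i ≥ 1`). [folklore] -/
theorem genSwap_ipTransferMatrixW {i : ℕ} (hi : i ≠ 0) (q : K₀) (Q Q' : ColPattern m) :
    genSwap K₀ i (ipTransferMatrixW m (genC K₀ q) (genW K₀) (genZ K₀) Q Q') =
      ipTransferMatrixW m (genC K₀ q) (genW K₀) (zswap (genZ K₀) i) Q Q' := by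
  rw [show (genSwap K₀ i : RapidityField K₀ → RapidityField K₀) = (genSwap K₀ i).toRingHom from rfl,
    map_ipTransferMatrixW]
  simp only [RingEquiv.toRingHom_eq_coe, RingEquiv.coe_toRingHom, genSwap_genC, genSwap_genW hi]
  congr 1
  funext k
  exact genSwap_genZ i k

end Swap

end Literature.Probability.Percolation
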